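import Mathlib.Topology.Baire.Lemmas
import Mathlib.Topology.Baire.LocallyCompactRegular
import Mathlib.Order.Filter.CountablyGenerated
import Literature.AnabelianGeometry.SemiGraphs.TemperedCurvesAugOpen
import Literature.AnabelianGeometry.SemiGraphs.TemperedCurveBridge
import Literature.NumberTheory.GaloisRepresentations.AbsGaloisGroupCompact
import HarnessLib

/-!
# The open mapping theorem for tempered groups; `AugIsOpenMap` is a theorem

Mochizuki, *Semi-graphs of anabelioids*, Publ. RIMS **42** (2006), Example 3.10 p. 43
[cite: MochizukiSemiAnbd2006, Ex 3.10 p.43]: `π₁^temp(X_K)` "fits into a natural exact sequence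
`1 → π₁^temp(X_K̄) → π₁^temp(X_K) → G_K → 1`" of topological groups, i.e. the augmentation
`Π^tp ↠ G_K` is an OPEN map.  The interface file `TemperedCurvesAugOpen.lean` records this as the
named hypothesis `TemperedArithmeticGroup.AugIsOpenMap` (ruling ο2 of abc-iut-L3-lead), on the
grounds that openness is not derivable from continuity + surjectivity alone.

This proof-only file shows that it IS derivable from the frozen fields of
`TemperedArithmeticGroup` — because the tree's `IsTempered` (`TemperedGroups.lean`, Def. 3.1 (i))
is the COMPLETE inverse-limit form (clause `complete`: compatible cosets modulo the open normal
subgroups come from an element) and the interface records Galois-countability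
(`secondCountableTopology`).  The engine is an open mapping theorem for tempered groups:

* `IsTempered.isOpen_closure_map` — Baire step: for a surjective homomorphism `f : G ↠ H` of a
  tempered group onto a Baire topological group and an open subgroup `N ≤ G` (of countable index,
  Rmk. 3.1.2), the closure of `f(N)` is an OPEN subgroup of `H`;
* `IsTempered.closure_map_subset_image` — completeness step: along a decreasing cofinal sequence of
  open normal subgroups `N₀ ⊇ N₁ ⊇ ⋯`, successive approximation produces a left-Cauchy product
  `g₀ g₁ g₂ ⋯`, which converges by clause `complete`; Hausdorffness of `H` gives
  `⋂ₙ cl f(Nₙ) = {1}`, whence `cl f(N₀) ⊆ f(N₀)`;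
* `IsTempered.isOpenMap_of_surjective` — a continuous surjective homomorphism from a tempered group
  with first-countable topology onto a Hausdorff Baire topological group is open
  (classical for Polish groups: Banach 1932 / Pettis 1950; for σ-compact locally compact groups
  Mathlib's `MonoidHom.isOpenMap_of_sigmaCompact`; the tempered case needs neither).

Consequences (no field of any frozen structure is touched; all additive):

* `TemperedArithmeticGroup.augIsOpenMap_holds : T.AugIsOpenMap` for EVERY
  `T : TemperedArithmeticGroup K` (target `G_K` compact Hausdorff, by
  `absoluteGaloisGroup_compactSpace`), so consumers may drop the binder `(h : T.AugIsOpenMap)`;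
* `TemperedCurve.isOpenMap_aug_of_isTempered` / `TemperedCurve.isOpenMap_aug_of_groupLevelData`:
  for the §6 interface `X : TemperedCurve p` the hypothesis `IsOpenMap X.aug` carried by the
  [EtTh] §2 model files (`haugOpen`) follows from `IsTempered X.PiTemp` + Galois-countability,
  i.e. from the parameter bundle `X.GroupLevelData` (ruling η′).

Refereed pre-IUT material; nothing here bears on [IUTchIII] Cor. 3.12; typed ≠ discharged.
-/

open Topology Filter Set
open scoped Pointwise

namespace Literature.AnabelianGeometry.SemiGraphs

universe u v

section Engine

variable {G : Type u} [Group G] [TopologicalSpace G]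
variable {H : Type v} [Group H] [TopologicalSpace H] [IsTopologicalGroup H]

/-- **Baire step.** For a surjective homomorphism `f : G ↠ H` from a tempered group onto a Baire
topological group and an open subgroup `N ≤ G`, the closure of `f(N)` is an open subgroup of `H`:
`N` has countable index ([SemiAnbd] Rmk. 3.1.2), so `H` is a countable union of translates of the
closed set `cl f(N)`, one of which has an interior point by the Baire category theorem.
[cite: MochizukiSemiAnbd2006, Rmk 3.1.2 p.33] -/
theorem IsTempered.isOpen_closure_map [BaireSpace H] (hG : IsTempered G) (f : G →* H)
    (hs : Function.Surjective f) (N : Subgroup G) (hN : IsOpen (N : Set G)) :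
    IsOpen ((N.map f).topologicalClosure : Set H) := by
  classical
  haveI : Countable (G ⧸ N) := hG.countable_quotient N hN
  haveI : Nonempty H := ⟨1⟩
  set C : Set H := ((N.map f).topologicalClosure : Set H) with hCdef
  have hC : IsClosed C := Subgroup.isClosed_topologicalClosure _
  have hcov : (⋃ q : G ⧸ N, f q.out • C) = univ := by
    refine eq_univ_of_forall fun h => ?_
    obtain ⟨g, rfl⟩ := hs h
    refine mem_iUnion.2 ⟨(g : G ⧸ N), ?_⟩
    have hmem : ((g : G ⧸ N).out)⁻¹ * g ∈ N := by
      rw [← QuotientGroup.eq, QuotientGroup.out_eq']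
    refine ⟨f (((g : G ⧸ N).out)⁻¹ * g), ?_, ?_⟩
    · exact Subgroup.le_topologicalClosure _ (Subgroup.mem_map_of_mem f hmem)
    · simp only [map_mul, map_inv, smul_eq_mul, mul_inv_cancel_left]
  obtain ⟨q, hq⟩ := nonempty_interior_of_iUnion_of_closed
    (fun q : G ⧸ N => hC.smul (f q.out)) hcov
  rw [interior_smul] at hq
  obtain ⟨x, hx⟩ := hq.of_image
  exact Subgroup.isOpen_of_mem_nhds _ (mem_interior_iff_mem_nhds.1 hx)

/-- **Completeness step.** Let `f : G ↠ H` be a continuous surjective homomorphism from a tempered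
group onto a Hausdorff Baire topological group, and `N₀ ⊇ N₁ ⊇ ⋯` a decreasing sequence of open
normal subgroups of `G` cofinal in the neighbourhoods of `1`.  Then `cl f(N₀) ⊆ f(N₀)`: given
`h ∈ cl f(N₀)`, successive approximation (using that every `cl f(Nₙ)` is an open subgroup, Baire
step) yields `gₙ ∈ Nₙ` with `f(g₀⋯gₙ)⁻¹ h ∈ cl f(Nₙ₊₁)`; the left-Cauchy sequence `g₀⋯gₙ`
converges by clause `complete` of Def. 3.1 (i) (the tree's inverse-limit form of "tempered"), and
its limit `g ∈ N₀` satisfies `f(g) = h` because `⋂ₙ cl f(Nₙ) = {1}` (`H` Hausdorff).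
[cite: MochizukiSemiAnbd2006, Def 3.1(i) p.33] -/
theorem IsTempered.closure_map_subset_image [T2Space H] [BaireSpace H] (hG : IsTempered G)
    (f : G →* H) (hf : Continuous f) (hs : Function.Surjective f)
    (N : ℕ → OpenNormalSubgroup G) (hanti : ∀ ⦃m n : ℕ⦄, m ≤ n → (N n : Set G) ⊆ N m)
    (hcof : ∀ U ∈ 𝓝 (1 : G), ∃ k, (N k : Set G) ⊆ U) :
    (((N 0).toSubgroup.map f).topologicalClosure : Set H) ⊆ f '' (N 0 : Set G) := by
  classical
  -- the open subgroups `S n = cl f(N n)`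
  set S : ℕ → Subgroup H := fun n => ((N n).toSubgroup.map f).topologicalClosure with hSdef
  have hSopen : ∀ n, IsOpen (S n : Set H) := fun n =>
    hG.isOpen_closure_map f hs (N n).toSubgroup (N n).isOpen
  have hSanti : ∀ ⦃m n : ℕ⦄, m ≤ n → S n ≤ S m := fun m n hmn =>
    Subgroup.topologicalClosure_mono (Subgroup.map_mono fun g hg => hanti hmn hg)
  have hmapS : ∀ n {g : G}, g ∈ N n → f g ∈ S n := fun n g hg =>
    Subgroup.le_topologicalClosure _ (Subgroup.mem_map_of_mem f hg)
  -- one approximation step: `y ∈ S n` ⇒ some `g ∈ N n` with `(f g)⁻¹ * y ∈ S (n+1)`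
  have hstep : ∀ n, ∀ y ∈ S n, ∃ g : G, g ∈ N n ∧ (f g)⁻¹ * y ∈ S (n + 1) := by
    intro n y hy
    have hy' : y ∈ closure (((N n).toSubgroup.map f : Subgroup H) : Set H) := by
      rw [← Subgroup.topologicalClosure_coe]; exact hy
    have hnhd : y • (S (n + 1) : Set H) ∈ 𝓝 y := by
      have h1 : (S (n + 1) : Set H) ∈ 𝓝 (1 : H) := (hSopen (n + 1)).mem_nhds (S (n + 1)).one_mem
      simpa using smul_mem_nhds_smul y h1
    obtain ⟨z, hzS, hzN⟩ := mem_closure_iff_nhds.1 hy' _ hnhd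
    obtain ⟨g, hg, rfl⟩ := hzN
    obtain ⟨s, hs', hsz⟩ := hzS
    refine ⟨g, hg, ?_⟩
    have : (f g)⁻¹ * y = s⁻¹ := by
      rw [← hsz]
      dsimp only
      rw [smul_eq_mul, mul_inv_rev, inv_mul_cancel_right]
    rw [this]
    exact (S (n + 1)).inv_mem hs'
  choose! step hstepN hstepS using hstep
  intro h hh
  -- the sequences: `y 0 = h`, `y (n+1) = (f (step n (y n)))⁻¹ * y n`; `x n = g₀ ⋯ g_{n-1}`
  let y : ℕ → H := fun n => Nat.rec h (fun k yk => (f (step k yk))⁻¹ * yk) n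
  have hy0 : y 0 = h := rfl
  have hySucc : ∀ n, y (n + 1) = (f (step n (y n)))⁻¹ * y n := fun n => rfl
  have hyS : ∀ n, y n ∈ S n := by
    intro n
    induction n with
    | zero => exact hh
    | succ n ih => rw [hySucc]; exact hstepS n (y n) ih
  let g : ℕ → G := fun n => step n (y n)
  have hgN : ∀ n, g n ∈ N n := fun n => hstepN n (y n) (hyS n)
  let x : ℕ → G := fun n => Nat.rec 1 (fun k xk => xk * g k) n
  have hx0 : x 0 = 1 := rfl
  have hxSucc : ∀ n, x (n + 1) = x n * g n := fun n => rfl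
  -- `y n = (f (x n))⁻¹ * h`
  have hyx : ∀ n, y n = (f (x n))⁻¹ * h := by
    intro n
    induction n with
    | zero => simp [hy0, hx0]
    | succ n ih =>
      show (f (g n))⁻¹ * y n = (f (x n * g n))⁻¹ * h
      rw [ih, map_mul, mul_inv_rev, mul_assoc]
  -- left-Cauchy: `(x m)⁻¹ * x n ∈ N m` for `m ≤ n`
  have hcauchy : ∀ m n, m ≤ n → (x m)⁻¹ * x n ∈ N m := by
    intro m n hmn
    induction n, hmn using Nat.le_induction with
    | base => simp
    | succ n hmn ih =>
      rw [hxSucc, ← mul_assoc]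
      exact (N m).toSubgroup.mul_mem ih (hanti hmn (hgN n))
  -- cosets modulo an open normal subgroup `M ⊇ N a, N b` agree
  have hcoset : ∀ (M : OpenNormalSubgroup G) (a b : ℕ), (N a : Set G) ⊆ M → (N b : Set G) ⊆ M →
      (QuotientGroup.mk (x a) : G ⧸ M.toSubgroup) = QuotientGroup.mk (x b) := by
    intro M a b ha hb
    rcases le_total a b with hab | hba
    · rw [QuotientGroup.eq]; exact ha (hcauchy a b hab)
    · rw [eq_comm, QuotientGroup.eq]; exact hb (hcauchy b a hba)
  -- an index `k M` with `N (k M) ⊆ M`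
  have hk : ∀ M : OpenNormalSubgroup G, ∃ k, (N k : Set G) ⊆ M := fun M =>
    hcof _ (M.toOpenSubgroup.mem_nhds_one)
  choose k hk using hk
  -- the compatible family and its limit
  obtain ⟨gl, hgl⟩ := hG.complete (fun M => (QuotientGroup.mk (x (k M)) : G ⧸ M.toSubgroup)) (by
    intro M M' hMM' a ha
    have haM' : (QuotientGroup.mk (x (k M)) : G ⧸ M'.toSubgroup) = QuotientGroup.mk a := by
      have := congrArg (Subgroup.quotientMapOfLE (show M.toSubgroup ≤ M'.toSubgroup from hMM')) ha
      simpa using this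
    rw [← haM']
    exact hcoset M' (k M') (k M) (hk M') ((hk M).trans fun z hz => hMM' hz))
  -- `(x n)⁻¹ * gl ∈ N n`
  have hlim : ∀ n, (x n)⁻¹ * gl ∈ N n := by
    intro n
    have h1 : (QuotientGroup.mk (x (k (N n))) : G ⧸ (N n).toSubgroup) = QuotientGroup.mk gl :=
      hgl (N n)
    have h2 : (QuotientGroup.mk (x (k (N n))) : G ⧸ (N n).toSubgroup) = QuotientGroup.mk (x n) :=
      hcoset (N n) _ _ (hk (N n)) subset_rfl
    rw [h2, QuotientGroup.eq] at h1
    exact h1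
  -- `(f gl)⁻¹ * h ∈ S n` for all `n`
  have hdiff : ∀ n, (f gl)⁻¹ * h ∈ S n := by
    intro n
    have : (f gl)⁻¹ * h = (f ((x n)⁻¹ * gl))⁻¹ * ((f (x n))⁻¹ * h) := by
      simp only [map_mul, map_inv, mul_inv_rev, inv_inv, mul_assoc, mul_inv_cancel_left]
    rw [this]
    exact (S n).mul_mem ((S n).inv_mem (hmapS n (hlim n))) (hyx n ▸ hyS n)
  -- `⋂ S n = {1}` by Hausdorffness: hence `f gl = h`
  have heq : f gl = h := by
    by_contra hne
    have hne' : (f gl)⁻¹ * h ≠ 1 := by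
      intro h1; exact hne (inv_mul_eq_one.1 h1)
    -- a closed neighbourhood of `1` avoiding `(f gl)⁻¹ * h`
    obtain ⟨V, ⟨hV1, hVc⟩, hVsub⟩ := (closed_nhds_basis (1 : H)).mem_iff.1
      (isOpen_compl_singleton.mem_nhds (show (1 : H) ∈ ({(f gl)⁻¹ * h}ᶜ : Set H) from
        fun h1 => hne' (mem_singleton_iff.1 h1).symm))
    have hpre : f ⁻¹' V ∈ 𝓝 (1 : G) := by
      apply hf.continuousAt.preimage_mem_nhds
      simpa using hV1
    obtain ⟨n, hn⟩ := hcof _ hpre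
    have hSV : (S n : Set H) ⊆ V := by
      rw [hSdef, Subgroup.topologicalClosure_coe]
      refine closure_minimal ?_ hVc
      rintro _ ⟨z, hz, rfl⟩
      exact hn hz
    exact hVsub (hSV (hdiff n)) rfl
  refine ⟨gl, ?_, heq⟩
  have := hlim 0
  simpa [hx0] using this

/-- **Open mapping theorem for tempered groups.** A continuous surjective homomorphism from a
tempered group whose topology is first countable (e.g. Galois-countable, [IUTchI] Rmk. 2.5.3 (i))
onto a Hausdorff Baire topological group (e.g. a profinite group) is an open map.  Proof: pick a
decreasing cofinal sequence of open normal subgroups (Rmk. 3.1.2 + first countability) and combine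
the Baire and completeness steps.  (Classical analogues: Banach's open mapping theorem for Polish
groups; Mathlib `MonoidHom.isOpenMap_of_sigmaCompact` for σ-compact locally compact groups.)
[cite: MochizukiSemiAnbd2006, Def 3.1(i) p.33] -/
theorem IsTempered.isOpenMap_of_surjective [IsTopologicalGroup G] [FirstCountableTopology G]
    [T2Space H] [BaireSpace H]
    (hG : IsTempered G) (f : G →* H) (hf : Continuous f) (hs : Function.Surjective f) :
    IsOpenMap f := by
  classical
  -- an antitone basis of open normal subgroups
  haveI : (𝓝 (1 : G)).IsCountablyGenerated := inferInstance
  obtain ⟨N, -, hNb⟩ := hG.hasBasis_nhds_one.exists_antitone_subbasis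
  have hanti : ∀ ⦃m n : ℕ⦄, m ≤ n → (N n : Set G) ⊆ N m := fun m n hmn => hNb.antitone hmn
  have hcof : ∀ U ∈ 𝓝 (1 : G), ∃ k, (N k : Set G) ⊆ U := fun U hU => hNb.mem_iff.1 hU
  rw [IsTopologicalGroup.isOpenMap_iff_nhds_one]
  intro U hU
  obtain ⟨n, hn⟩ := hcof _ (Filter.mem_map.1 hU)
  -- shift the sequence to start at `n`
  have hsub := hG.closure_map_subset_image f hf hs (fun k => N (n + k))
    (fun m m' hmm' => hanti (Nat.add_le_add_left hmm' n))
    (fun V hV => by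
      obtain ⟨k, hk⟩ := hcof V hV
      exact ⟨k, (hanti (Nat.le_add_left k n)).trans hk⟩)
  have hopen : IsOpen ((((N (n + 0)).toSubgroup.map f).topologicalClosure : Subgroup H) : Set H) :=
    hG.isOpen_closure_map f hs _ (N (n + 0)).isOpen
  refine Filter.mem_of_superset (hopen.mem_nhds (Subgroup.one_mem _)) ?_
  intro z hz
  obtain ⟨g, hg, rfl⟩ := hsub hz
  exact hn hg

end Engine

/-! ## [SemiAnbd] Example 3.10: the augmentation `Π^tp ↠ G_K` is open — unconditionally -/

namespace TemperedArithmeticGroup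

variable {K : Type u} [Field K] (T : TemperedArithmeticGroup K)

/-- **`AugIsOpenMap` is a theorem** ([SemiAnbd] Ex. 3.10 p. 43: "`1 → π₁^temp(X_K̄) → π₁^temp(X_K)
→ G_K → 1`" is an exact sequence of topological groups): for EVERY `T : TemperedArithmeticGroup K`
the augmentation `T.aug : Π^tp ↠ G_K` is an open map — by the open mapping theorem for tempered
groups (`IsTempered.isOpenMap_of_surjective`) applied to the frozen fields `isTempered`,
`secondCountableTopology`, `aug_surjective`, the target `G_K = Gal(K̄/K)` being compact Hausdorff
(`absoluteGaloisGroup_compactSpace`), hence Baire.  Consumers may discharge the binder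
`(h : T.AugIsOpenMap)` with this theorem. [cite: MochizukiSemiAnbd2006, Ex 3.10 p.43] -/
theorem augIsOpenMap_holds : T.AugIsOpenMap := by
  haveI := T.secondCountableTopology
  haveI : CompactSpace (Field.absoluteGaloisGroup K) :=
    Literature.NumberTheory.GaloisRepresentations.absoluteGaloisGroup_compactSpace K
  exact T.isTempered.isOpenMap_of_surjective T.aug.toMonoidHom T.aug.continuous T.aug_surjective

/-- The augmentation is an open quotient map: `G_K` carries the quotient topology of `Π^tp`
([SemiAnbd] Ex. 3.10 p. 43), unconditionally. [cite: MochizukiSemiAnbd2006, Ex 3.10 p.43] -/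
theorem isOpenQuotientMap_aug : IsOpenQuotientMap T.aug :=
  T.isOpenQuotientMap_aug_of T.augIsOpenMap_holds

/-- The augmentation is a quotient map, unconditionally. [cite: MochizukiSemiAnbd2006, Ex 3.10 p.43] -/
theorem isQuotientMap_aug : Topology.IsQuotientMap T.aug :=
  T.isQuotientMap_aug_of T.augIsOpenMap_holds

end TemperedArithmeticGroup

/-! ## [SemiAnbd] §6 interface `TemperedCurve`: `IsOpenMap X.aug` from temperedness -/

namespace TemperedCurve

variable {p : ℕ} [Fact p.Prime]

/-- For the §6 interface `X : TemperedCurve p` ([SemiAnbd] §6 p. 69: "`1 → Δ^temp_X → Π^temp_{X_K} →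
G_K → 1`"), the range-restricted augmentation `augGK : Π^temp_{X_K} ↠ G_K` is an OPEN map as soon as
`Π^temp_{X_K}` is tempered (Def. 3.1 (i)) with first-countable topology (Galois-countable,
[IUTchI] Rmk. 2.5.3 (i)): `G_K = Fix(K) ≤ Gal(ℚ̄_p/ℚ_p)` is an open (`K/ℚ_p` finite), hence closed,
subgroup of a compact Hausdorff group. [cite: MochizukiSemiAnbd2006, §6 p.69] -/
theorem isOpenMap_augGK_of_isTempered (X : TemperedCurve p) (hX : IsTempered X.PiTemp)
    [FirstCountableTopology X.PiTemp] : IsOpenMap X.augGK := by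
  haveI : IsGalois ℚ_[p] (AlgebraicClosure ℚ_[p]) := {}
  haveI : T2Space (GQp p) := krullTopology_t2
  haveI := X.finiteDimensional_K
  have hclosed : IsClosed (X.GK : Set (GQp p)) :=
    OpenSubgroup.isClosed ⟨X.GK, IntermediateField.fixingSubgroup_isOpen X.K⟩
  haveI : CompactSpace X.GK := isCompact_iff_compactSpace.1 hclosed.isCompact
  exact hX.isOpenMap_of_surjective X.augGK.toMonoidHom X.augGK.continuous X.augGK_surjective

/-- For `X : TemperedCurve p` with `Π^temp_{X_K}` tempered and first countable, the augmentation
`aug : Π^temp_{X_K} → Gal(ℚ̄_p/ℚ_p)` (with open image `G_K`) is an OPEN map — the hypothesis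
`IsOpenMap X.aug` / `haugOpen` carried by the [EtTh] §2 model files is thereby reduced to the
printed properties "`Π^temp` tempered, Galois-countable". [cite: MochizukiSemiAnbd2006, §6 p.69] -/
theorem isOpenMap_aug_of_isTempered (X : TemperedCurve p) (hX : IsTempered X.PiTemp)
    [FirstCountableTopology X.PiTemp] : IsOpenMap X.aug := by
  haveI := X.finiteDimensional_K
  have hopen : IsOpen (X.GK : Set (GQp p)) := IntermediateField.fixingSubgroup_isOpen X.K
  have hcomp : (X.aug : X.PiTemp → GQp p) = Subtype.val ∘ X.augGK := by
    funext g; rfl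
  rw [hcomp]
  exact hopen.isOpenMap_subtype_val.comp (X.isOpenMap_augGK_of_isTempered hX)

/-- With the parameter bundle `d : X.GroupLevelData` (ruling η′: "`Π^temp` tempered", "Galois-
countable" are parameters of the §6 interface), `IsOpenMap X.aug` holds with no further
hypothesis. [cite: MochizukiSemiAnbd2006, Ex 3.10 pp.43-45] -/
theorem isOpenMap_aug_of_groupLevelData (X : TemperedCurve p) (d : X.GroupLevelData) :
    IsOpenMap X.aug := by
  haveI := d.secondCountableTopology
  exact X.isOpenMap_aug_of_isTempered d.isTempered

end TemperedCurve

end Literature.AnabelianGeometry.SemiGraphs
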